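import Literature.MathematicalPhysics.QuantumFieldTheory.Balaban1983to89.Node00.Record13CarriersXPinnedHSCoPH
import Summits.QuantumFields.YangMills.Theorems.BalabanUVNodesN05SubBHKnitUnivT8Srv

/-!
v1.7 `CoPH` IMAGE (token map T₇ of dag-lead WORDS-143 ∕ node00-def-T `KEYMAP-Record13-v1.7.md`: binder `θ : Stage13HParams` (= `Stage13RParams` + the HISTORY-INDEXED residual 𝐓-weight slot `Zh`, director-ym №183 FINDING №9), `CoPR ↦ CoPH`, dotted `Stage13RParams.X ↦ Stage13HParams.X`, SITE-RULE `X F N θ ↦ X F N θ.toStage13Params` for the edition-free θ-level objects) of this seat's v1.6 file of the same stem (which STANDS as a settled helper, as does the v1.5 one); H-level pins over dag-n10-d's `Stage13HParams.rebindX` (`Node00/Record13CarriersCoPH` §0, p539476).  Prose pids ∕ FILE numbers below are those of the v1.5 ∕ v1.6 lineage where not updated; this image's v1.7 suppliers are node00-def-T FILE 27 p537939 `Record13CoPH` ∕ FILE 28T p539169 `Record13SepCoPH`, dag-n10-d g11 p539476 `Record13CarriersCoPH` ∕ p540513 `Record13CarriersSepCoPH` ∕ p542283 `Record13SClassSepCoPH`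 (the generic S-class `IsRecordOfRecord₁₃CSepCoPHS`, of which this seat's S-bound records are one-pin ∕ X-H-pin ∕ four-pin-view SLICES — membership lemmas `isRecordOfRecord₁₃CSepCoPHS_of_…` below).

# BalabanUVNodes ∕ N05 ([B8], `Dag.B8_main`) AT THE K1 ENGINE'S X-PINNED VIEW — PRINT'S BACKGROUND (v1.7 key `SepCoPH`), REPAIRED [B8] CARRIER, SOCKETS AT THE
# `Ω₀ = ℤᵈ` LAW MEMBERS, THEOREM 8 KNIT IN AND ITS [B8]-OWN SOURCED SOCKETS SERVED: N05 in ∃-currency at the S-BOUND X-PINNED record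
# `Node00.IsRecordOfRecord₁₃CSepCoPHSX3H` (`Node00/Record13CarriersXPinnedHSCoPH`: [B8] at the repaired members at the cut layer, [B12] ∕ [B13] at ANY `lam12 lam13`)
# (+ the same-datum `₁₃CSepCoPH` companion at the C-bound H-X-pin), fed by `BalabanUVNodesN05SubBHKnitUnivT8Srv` — ONE world carrying N05's SURVIVING leaf together with
# the engine's N09 ∕ N10 X-sockets; display: `p6`, `p7` + [4]-type sockets at `Ω₀ = ℤᵈ` members only

Track A of `YM-PLAN.md` (cell `pub-ymgap`, HUMAN RULING D-0062), node **N05** = [Balaban1985RegularSpaces] Lemma 1, Thm 2, Prop 3, Thm 4, Props 5–7, Thm 8; seat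
`pub-ymgap-dag-n05-d` (g6), 2026-08-27; this seat's LOCATED-XPIN (the un-repaired X-pin's N05 socket is unservable, `BalabanUVNodesN05XPinVacuity`) and its repair
`Node00/Record13CarriersXPinnedH(S)`.  Inputs BY NAME: `BalabanUVNodesN05SubBHKnitUnivT8Srv.b8LeafOfRecordSubBH_cutSubB_zdLan_of_knit_lettersRDUB_univ_t8srv` (p521275),
`Node00/Record13CarriersXPinnedHSCoPH` (the S-bound X-pinned v1.7 record, companion, faces), `Node00/Record13CarriersXPinnedH(CoPH)` (`socket05S_toStage5₁₃CoPH_pinX3H_iff`).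

WHAT IS PROVED (composition BY NAME; no estimate; no new definition):
* ★ **`exists_isRecordOfRecord₁₃CSepCoPHSX3H_b8_of_knit_lettersRDUB_univ_t8srv`** — N05 AT THE H-X-PIN, FED BY THE SERVED KNIT, for ANY `lam12 lam13`: ADMISSIBLE `θ : Stage13HParams F N`
  WITH v1.7 PROVISOS `h` and the knit's inputs AT `θ.toStage3Params` (record constants; [4]'s letters `SLet ∕ SLetUB` and the b9 socket `SB9all` at the `Ω₀ = ℤᵈ` law members, [4]'s
  letters at the Prop-5 members `SLetL ∕ SLetLU`; the Prop.-5 index map `ι` with its three member laws; the printed members `p6` (at `c₁`) and `p7`; Theorem 8's constants, layer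
  equations and sourced guard; the two SOURCED b9 sockets `SH59src` ∕ `SB9srcH` at `Ω₀ = ℤᵈ` members) ⇒ for every `γw ∈ ]0, θ.γ]`, `∃ w w′`:
  `IsRecordOfRecord₁₃CSepCoPHSX3H F N (datumOfRecord₁₃SepCoPH θ h) w` with its binding DISPLAYED at `θ.pinX3H (λ.cutSubB J (zdLan ∘ ι) c₁) lam12 lam13`, EVERY run's `b8` leaf and
  `Dag.B8_main (leavesP w P)`, and the same-datum companion `IsRecordOfRecord₁₃CSepCoPH … w′` (leaves equal off `b8`; the companion's typed `b8` NOT claimed).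
So at the engine's view the other X-sockets (N09 at `lam12`, N10 at `lam13`, `socket09∕10_pinX3H_iff`) and the Y ∕ Z ∕ W leaves are read at the SAME world as N05.
HONEST FRAMING: kernel bookkeeping by name; all sockets are HYPOTHESES; `p6 ∕ p7` are HYPOTHESES = N05's own printed members NOT discharged; count-neutral; **N05 NOT discharged**;
K1 NOT claimed; Bałaban AS PRINTED with locators; one finite 𝕋⁴ programme at fixed ε; nothing continuum ∕ ℝ⁴ ∕ OS ∕ mass-gap ∕ Clay.  No `sorry`, no new definition.
[cite: Balaban1985RegularSpaces, Lemma 1 p.79, Thm 2 p.83, Prop. 3 p.87, Thm 4 p.88, Prop. 5 (1.106)–(1.110) p.94, Thm 8 (1.146) p.101 (supplied modulo [4]-type sockets); Prop. 6 (1.131)–(1.133) p.99, Prop. 7 p.100 (named hypotheses); Balaban1985BackgroundPropagators, Thm 3.1 p.397, Thm 3.3 p.398, (3.25) p.394 (letters and b9 sockets, hypotheses); Balaban1989LargeFieldII, Thm 1 + (0.1) pp.355–356; Balaban1988Convergent, p.244, (2.12)–(2.13) pp.256–257 (the record at print's background, bookkeeping)]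
-/noncomputable section

namespace Summit.QuantumFields.YangMills.BalabanUVNodes.N05AtXPinnedHSSepCoPHT8Srv


open Literature.MathematicalPhysics.QuantumFieldTheory.Balaban1983to89
open Literature.MathematicalPhysics.QuantumFieldTheory.Balaban1983to89.Node00
open Literature.MathematicalPhysics.QuantumFieldTheory.Balaban1983to89.T4Continuum
open Literature.MathematicalPhysics.QuantumFieldTheory.Balaban1983to89.DagBinding
open Literature.MathematicalPhysics.QuantumFieldTheory.Balaban1983to89.B8IdxB8LawsB (towerBonds IdxB8LawsB IdxB8SubB famB8OfRecordSubB)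
open Literature.MathematicalPhysics.QuantumFieldTheory.Balaban1983to89.B8LeafModelZd (ZdIdx)
open Literature.MathematicalPhysics.QuantumFieldTheory.Balaban1983to89.B8LeafModelZd3 (SockB9P3)
open Literature.MathematicalPhysics.QuantumFieldTheory.Balaban1983to89.B8LeafModelZd3H (zdGF3H)
open Literature.MathematicalPhysics.QuantumFieldTheory.Balaban1983to89.B8SockLettersRD (SockLettersRD)
open Literature.MathematicalPhysics.QuantumFieldTheory.Balaban1983to89.B8Lemma1NonAbelian (mulCfg blockPairNA)
open Literature.MathematicalPhysics.QuantumFieldTheory.Balaban1983to89.B8Eq131CubesAdmissible (cubeFam)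
open Literature.MathematicalPhysics.QuantumFieldTheory.Balaban1983to89.B8CubeMemberZd (cubeLamS cubeLamB)
open Literature.MathematicalPhysics.QuantumFieldTheory.Balaban1983to89.B8Prop5LandauDataZd (ZdLanIdx zdLan)
open MatrixLog B7Prop1Explicit B7Prop2Explicit B7Prop1Local B7Eq92Concrete
open B8Ineq130 (tlo thi)
open B8Ineq132 (InAk covDerivFwd)
open B7Eq78Linearization (zdBlocking QprimeIter)
open B8Eq119TwistedAxial (bgT Restr129 InAx)
open B8Eq140Level (SideTouches)
open B8Eq138LandauZd (covLap QT InR138 IsLandau146W)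
open B8Eq1117Concrete (XSpace)
open B8Prop5ContractionKLevel (Bd2)
open B8LambdaSpaceKLevel (wt)
open B8Eq184Proof (gaugeExp cfgExp)
open B8Eq146AExpansion (iEta)
open B7Prop4GeneralLevels (linCovIter)
open B8Eq155JBound (Jcur wsup)
open B8ScaledSupNorm (bondNorm msup Bdd)
open B8Thm2LogB (blockTop)

open Literature.MathematicalPhysics.QuantumFieldTheory.Balaban1983to89.B8LanF146 (LanF146)
open Summit.QuantumFields.YangMills.BalabanUVNodes.N05SubBHKnitUnivT8Srv (b8LeafOfRecordSubBH_cutSubB_zdLan_of_knit_lettersRDUB_univ_t8srv)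
open B8Eq146AExpansion (plaqCovDeriv)
open B8Eq143PlaqExpansion (pdiv)
open B9Eq340HolderZd (hquot AdmPair)

-- `Site` alone could resolve to the torus sites of `Setup.lean`; re-export the `ℤ^d` sites of `B7Prop1Explicit`.
export B7Prop1Explicit (Site)

/-! ## ★ N05 in ∃-currency at the S-bound X-pinned v1.7 record (the engine's view), FED BY THE SERVED KNIT -/

section Record

variable {F : T4Family} {N : ℕ} [NeZero N]

/-- ★ **N05 IN ∃-CURRENCY AT THE STAGE-13 RECORD OF RECORD — print's background (v1.7 key), repaired carrier, sockets at the `Ω₀ = ℤᵈ` law members, Theorem 8 knit in, its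
[B8]-own sourced sockets SERVED** (one-pin S-bound record + same-datum `₁₃CSepCo` companion).  ADMISSIBLE Stage-13 parameters `θ` WITH v1.7 PROVISOS `h` and the inputs of
`BalabanUVNodesN05SubBHKnitUnivT8Srv.b8LeafOfRecordSubBH_cutSubB_zdLan_of_knit_lettersRDUB_univ_t8srv` AT `θ.toStage3Params` — record constants; [4]'s letters (`SLet`, `SLetUB`) and
the b9 socket (`SB9all`) at the `Ω₀ = ℤᵈ` LAW members, [4]'s letters at the Prop-5 members (`SLetL`, `SLetLU`); the Prop.-5 index map `ι` with its three member laws; the printed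
members `p6` (Prop. 6 p. 99, at the cut constant `c₁`) and `p7` (Prop. 7 p. 100); Theorem 8's constants, layer equations and sourced guard; the two SOURCED b9 sockets `SH59src` (at
(1.146), Thm 4's frame, threshold `c59`) and `SB9srcH` (Prop. 3's frame, threshold `cP3`) at `Ω₀ = ℤᵈ` members — give, for every window `γw ∈ ]0, θ.γ]`, worlds `w w′`:
`IsRecordOfRecord₁₃CSepCoPHSX3H F N (datumOfRecord₁₃SepCoPH θ h) w` with its binding DISPLAYED at `θ.pinX3H (λ.cutSubB J (zdLan ∘ ι) c₁) lam12 lam13`, EVERY run's `b8` leaf and `Dag.B8_main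
(leavesP w P)`, and the same-datum companion `IsRecordOfRecord₁₃CSepCoPH … w′` (leaves equal off `b8`; the companion's typed `b8` NOT claimed).  NOT a discharge of N05: `p6`, `p7`,
the letters families and the b9 ∕ sourced-b9 sockets are hypotheses.
[cite: Balaban1985RegularSpaces, Lemma 1 p.79, Thm 2 p.83, Prop. 3 p.87, Thm 4 p.88, Prop. 5 p.94, Thm 8 (1.146) p.101; Prop. 6 p.99, Prop. 7 p.100 (named hypotheses); Balaban1985BackgroundPropagators, Thm 3.1 p.397, Thm 3.3 p.398 (hypotheses); Balaban1989LargeFieldII, Thm 1 + (0.1) pp.355–356 (the record, bookkeeping)] -/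
theorem exists_isRecordOfRecord₁₃CSepCoPHSX3H_b8_of_knit_lettersRDUB_univ_t8srv (θ : Stage13HParams F N) (h : θ.Provisos₁₃SepCoPH F N) (hθ : θ.Admissible F N)
    (lam12 : ResidB12 F N θ.τ9.M) (lam13 : B12.RunParams → ResidB13 θ.toStage3Params)
    (lam : ResidB8 θ.toStage3Params) (hD : 2 ≤ θ.toStage3Params.D)
    (hB₁' : lam.B₁' = 5 * (θ.toStage3Params.D : ℝ) * θ.toStage3Params.L * lam.inp.B₀)
    {cB9 B₀'H B₂' BG BR cL : ℝ} (hB : 2 ≤ 5 * (θ.toStage3Params.D : ℝ) * θ.toStage3Params.L * lam.inp.B₀) (hB₀β : 0 < lam.B₀β) (hC₂ : 2097152 * ((θ.toStage3Params.D : ℝ) + 1) ^ 2 ≤ lam.C₂)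
    (hcB9 : 0 < cB9) (hB₀'H : 0 < B₀'H) (hB₂' : 0 ≤ B₂') (hBG : 0 ≤ BG) (hBR : 0 ≤ BR) (hcL : 0 < cL)
    (hfree : 3 * (2 * (θ.toStage3Params.D : ℝ) * (θ.toStage3Params.L : ℝ) ^ 2) * BG * BR ≤ lam.inp.B₀')
    -- the free-constant condition of the Prop.-5 provider (at half `B₀′`)
    (hfree2 : 3 * (2 * (θ.toStage3Params.D : ℝ) * (θ.toStage3Params.L : ℝ) ^ 2) * BG * BR ≤ lam.inp.B₀' / 2)
    -- [4]'s letters and the b9 socket AT THE `Ω₀ = ℤᵈ` LAW MEMBERS ONLY (= the sub-index of record `IdxB8SubB θ.toStage3Params`; the cube members are EXCLUDED): existence side (laws on print's domains) and uniqueness side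
    (SLet : ∀ i : ZdIdx θ.toStage3Params.D θ.toStage3Params.L, i.Ω 0 = Set.univ → IdxB8LawsB θ.toStage3Params.L i → SockLettersRD (𝔸 := θ.toStage3Params.𝔸) θ.toStage3Params.L BG BR B₀'H B₂' cL i.η i.k i.Ω i.Λs)
    (SLetUB : ∀ i : ZdIdx θ.toStage3Params.D θ.toStage3Params.L, i.Ω 0 = Set.univ → IdxB8LawsB θ.toStage3Params.L i → ∀ α₀ : ℝ, 0 < α₀ → α₀ ≤ cL → ∀ U₀ : Site θ.toStage3Params.D → Fin θ.toStage3Params.D → θ.toStage3Params.𝔸ˣ, (∀ x κ, U₀ x κ ∈ unitaryUnits θ.toStage3Params.𝔸) →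
      InAk θ.toStage3Params.L i.k i.η α₀ i.Ω U₀ →
      ∃ (g Δ : (Site θ.toStage3Params.D → θ.toStage3Params.𝔸) →ₗ[ℂ] (Site θ.toStage3Params.D → θ.toStage3Params.𝔸)) (q : (Site θ.toStage3Params.D → θ.toStage3Params.𝔸) →ₗ[ℂ] (ℕ → Site θ.toStage3Params.D → θ.toStage3Params.𝔸))
        (qs : (ℕ → Site θ.toStage3Params.D → θ.toStage3Params.𝔸) →ₗ[ℂ] (Site θ.toStage3Params.D → θ.toStage3Params.𝔸)) (Aw c : (ℕ → Site θ.toStage3Params.D → θ.toStage3Params.𝔸) →ₗ[ℂ] (ℕ → Site θ.toStage3Params.D → θ.toStage3Params.𝔸))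
        (H' : XSpace θ.toStage3Params.D i.k θ.toStage3Params.𝔸 →ₗ[ℂ] (Site θ.toStage3Params.D → θ.toStage3Params.𝔸)),
        (∀ x : Site θ.toStage3Params.D → θ.toStage3Params.𝔸, (∃ C : ℝ, ∀ y, ‖x y‖ ≤ C) → g (Δ x + qs (Aw (q x))) = x) ∧ (∀ φ, qs (c (q (g (g (qs φ))))) = qs φ) ∧
        (∀ (f : Site θ.toStage3Params.D → θ.toStage3Params.𝔸), ∀ x ∈ i.Ω 0, Δ f x = covLap i.η U₀ ((i.Ω 0).indicator f) x) ∧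
        (∀ (μ : ℕ → Site θ.toStage3Params.D → θ.toStage3Params.𝔸), ∀ x ∈ i.Ω 0, qs μ x = QT θ.toStage3Params.L i.k (i.Λs i.k) U₀ μ x) ∧
        (∀ (f : Site θ.toStage3Params.D → θ.toStage3Params.𝔸) (n : ℕ), n ≤ i.k → ∀ y ∈ i.Λs i.k n, q f n y = QprimeIter (zdBlocking θ.toStage3Params.D θ.toStage3Params.L) (bgT θ.toStage3Params.L U₀) n f y) ∧
        (∀ (f : Site θ.toStage3Params.D → θ.toStage3Params.𝔸) (n : ℕ) (y : Site θ.toStage3Params.D), ¬ (n ≤ i.k ∧ y ∈ i.Λs i.k n) → q f n y = 0) ∧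
        (∀ (X : XSpace θ.toStage3Params.D i.k θ.toStage3Params.𝔸) (x : Site θ.toStage3Params.D), ‖H' X x‖ ≤ B₀'H * ‖X‖) ∧
        (∀ n, n ≤ i.k → ∀ (X : XSpace θ.toStage3Params.D i.k θ.toStage3Params.𝔸), ∀ p ∈ {b : Site θ.toStage3Params.D × Fin θ.toStage3Params.D | SideTouches (i.Ω n) b.1 b.2},
          wt θ.toStage3Params.L i.η n * ‖covDerivFwd i.η U₀ p.2 (H' X) p.1‖ ≤ B₀'H * ‖X‖) ∧
        (∀ X : XSpace θ.toStage3Params.D i.k θ.toStage3Params.𝔸, Bd2 θ.toStage3Params.L i.η i.k i.Ω (covLap i.η U₀ (H' X)) (B₂' * ‖X‖)) ∧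
        (∀ (Y : XSpace θ.toStage3Params.D i.k θ.toStage3Params.𝔸) (n : ℕ) (hn : n ≤ i.k) (y : Site θ.toStage3Params.D), y ∈ i.Λs i.k n →
          QprimeIter (zdBlocking θ.toStage3Params.D θ.toStage3Params.L) (bgT θ.toStage3Params.L U₀) n (H' Y) y = Y (⟨n, Nat.lt_succ_of_le hn⟩, y)) ∧
        (∀ (f : Site θ.toStage3Params.D → θ.toStage3Params.𝔸) (r : ℝ), 0 ≤ r → Bd2 θ.toStage3Params.L i.η i.k i.Ω f r →
          (∀ x, ‖g f x‖ ≤ BG * r) ∧ ∀ n, n ≤ i.k → ∀ p ∈ {b : Site θ.toStage3Params.D × Fin θ.toStage3Params.D | SideTouches (i.Ω n) b.1 b.2},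
            wt θ.toStage3Params.L i.η n * ‖covDerivFwd i.η U₀ p.2 (g f) p.1‖ ≤ BG * r) ∧
        (∀ (f : Site θ.toStage3Params.D → θ.toStage3Params.𝔸) (r : ℝ), 0 ≤ r → Bd2 θ.toStage3Params.L i.η i.k i.Ω f r → Bd2 θ.toStage3Params.L i.η i.k i.Ω (f - g (qs (c (q (g f))))) (BR * r)))
    (SB9all : ∀ i : ZdIdx θ.toStage3Params.D θ.toStage3Params.L, i.Ω 0 = Set.univ → IdxB8LawsB θ.toStage3Params.L i → ∀ m, m ≤ i.k →
      SockB9P3 (𝔸 := θ.toStage3Params.𝔸) θ.toStage3Params.L lam.inp.B₀ lam.B₀β cB9 lam.β lam.len i.η m i.Ω i.Λs i.Λb)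
    -- PROPOSITION 5's INDEX READ AS OBJECTS: `zdLan` members obeying the member laws, with [4]'s letters at each (RD currency)
    {J : Type} (ι : J → ZdLanIdx θ.toStage3Params.D θ.toStage3Params.𝔸)
    (hΩ0L : ∀ a : J, (ι a).Ω 0 = Set.univ) (hΩL : ∀ a : J, ∀ j, (ι a).Ω (j + 1) ⊆ (ι a).Ω j)
    (htowerL : ∀ a : J, ∀ j, j ≤ (ι a).k → ∀ y ∈ (ι a).Λ j, ∀ x, InBox (tlo θ.toStage3Params.L y j) (thi θ.toStage3Params.L y j) x → x ∈ (ι a).Ω j)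
    (SLetL : ∀ a : J, ∀ α₀ : ℝ, 0 < α₀ → α₀ ≤ cL → InAk θ.toStage3Params.L (ι a).k (ι a).η α₀ (ι a).Ω (ι a).U₀ →
      ∃ (g Δ : (Site θ.toStage3Params.D → θ.toStage3Params.𝔸) →ₗ[ℂ] (Site θ.toStage3Params.D → θ.toStage3Params.𝔸)) (q : (Site θ.toStage3Params.D → θ.toStage3Params.𝔸) →ₗ[ℂ] (ℕ → Site θ.toStage3Params.D → θ.toStage3Params.𝔸))
        (qs : (ℕ → Site θ.toStage3Params.D → θ.toStage3Params.𝔸) →ₗ[ℂ] (Site θ.toStage3Params.D → θ.toStage3Params.𝔸)) (Aw c : (ℕ → Site θ.toStage3Params.D → θ.toStage3Params.𝔸) →ₗ[ℂ] (ℕ → Site θ.toStage3Params.D → θ.toStage3Params.𝔸))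
        (H' : XSpace θ.toStage3Params.D (ι a).k θ.toStage3Params.𝔸 →ₗ[ℂ] (Site θ.toStage3Params.D → θ.toStage3Params.𝔸)),
        (∀ x, ∀ y ∈ (ι a).Ω 0, (Δ (g x) + qs (Aw (q (g x)))) y = x y) ∧ (∀ f, q (g (g (qs (c (q f))))) = q f) ∧
        (∀ (f : Site θ.toStage3Params.D → θ.toStage3Params.𝔸), ∀ x ∈ (ι a).Ω 0, Δ f x = covLap (ι a).η (ι a).U₀ (((ι a).Ω 0).indicator f) x) ∧
        (∀ (μ : ℕ → Site θ.toStage3Params.D → θ.toStage3Params.𝔸), ∀ x ∈ (ι a).Ω 0, qs μ x = QT θ.toStage3Params.L (ι a).k (ι a).Λ (ι a).U₀ μ x) ∧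
        (∀ (f : Site θ.toStage3Params.D → θ.toStage3Params.𝔸) (j : ℕ), j ≤ (ι a).k → ∀ y ∈ (ι a).Λ j, q f j y = QprimeIter (zdBlocking θ.toStage3Params.D θ.toStage3Params.L) (bgT θ.toStage3Params.L (ι a).U₀) j f y) ∧
        (∀ (X : XSpace θ.toStage3Params.D (ι a).k θ.toStage3Params.𝔸) (x : Site θ.toStage3Params.D), ‖H' X x‖ ≤ B₀'H * ‖X‖) ∧
        (∀ j, j ≤ (ι a).k → ∀ (X : XSpace θ.toStage3Params.D (ι a).k θ.toStage3Params.𝔸), ∀ p ∈ {b : Site θ.toStage3Params.D × Fin θ.toStage3Params.D | SideTouches ((ι a).Ω j) b.1 b.2},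
          wt θ.toStage3Params.L (ι a).η j * ‖covDerivFwd (ι a).η (ι a).U₀ p.2 (H' X) p.1‖ ≤ B₀'H * ‖X‖) ∧
        (∀ X : XSpace θ.toStage3Params.D (ι a).k θ.toStage3Params.𝔸, Bd2 θ.toStage3Params.L (ι a).η (ι a).k (ι a).Ω (covLap (ι a).η (ι a).U₀ (H' X)) (B₂' * ‖X‖)) ∧
        (∀ (X : XSpace θ.toStage3Params.D (ι a).k θ.toStage3Params.𝔸) (x : Site θ.toStage3Params.D), x ∉ (ι a).Ω 0 → H' X x = 0) ∧
        (∀ X Y : XSpace θ.toStage3Params.D (ι a).k θ.toStage3Params.𝔸, (∀ p, Y p = -star (X p)) → ∀ x, H' Y x = -star (H' X x)) ∧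
        (∀ (Y : XSpace θ.toStage3Params.D (ι a).k θ.toStage3Params.𝔸) (j : ℕ) (hj : j ≤ (ι a).k) (y : Site θ.toStage3Params.D), y ∈ (ι a).Λ j →
          QprimeIter (zdBlocking θ.toStage3Params.D θ.toStage3Params.L) (bgT θ.toStage3Params.L (ι a).U₀) j (H' Y) y = Y (⟨j, Nat.lt_succ_of_le hj⟩, y)) ∧
        (∀ (f : Site θ.toStage3Params.D → θ.toStage3Params.𝔸) (r : ℝ), 0 ≤ r → Bd2 θ.toStage3Params.L (ι a).η (ι a).k (ι a).Ω f r →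
          (∀ x, ‖g f x‖ ≤ BG * r) ∧ ∀ j, j ≤ (ι a).k → ∀ p ∈ {b : Site θ.toStage3Params.D × Fin θ.toStage3Params.D | SideTouches ((ι a).Ω j) b.1 b.2},
            wt θ.toStage3Params.L (ι a).η j * ‖covDerivFwd (ι a).η (ι a).U₀ p.2 (g f) p.1‖ ≤ BG * r) ∧
        (∀ (f : Site θ.toStage3Params.D → θ.toStage3Params.𝔸) (x : Site θ.toStage3Params.D), x ∉ (ι a).Ω 0 → g f x = 0) ∧
        (∀ f : Site θ.toStage3Params.D → θ.toStage3Params.𝔸, (∀ j, j ≤ (ι a).k → ∀ x ∈ (ι a).Ω j, IsSelfAdjoint (f x)) → ∀ x, IsSelfAdjoint (g f x)) ∧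
        (∀ (f : Site θ.toStage3Params.D → θ.toStage3Params.𝔸) (r : ℝ), 0 ≤ r → Bd2 θ.toStage3Params.L (ι a).η (ι a).k (ι a).Ω f r →
          Bd2 θ.toStage3Params.L (ι a).η (ι a).k (ι a).Ω (f - g (qs (c (q (g f))))) (BR * r)) ∧
        (∀ f : Site θ.toStage3Params.D → θ.toStage3Params.𝔸, (∀ j, j ≤ (ι a).k → ∀ x ∈ (ι a).Ω j, IsSelfAdjoint (f x)) →
          ∀ j, j ≤ (ι a).k → ∀ x ∈ (ι a).Ω j, IsSelfAdjoint ((f - g (qs (c (q (g f))))) x)))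
    -- [4]'s UNIQUENESS letters at the Prop-5 members (left-inverse law of G′ on bounded functions), for Prop. 5's uniqueness clause there
    (SLetLU : ∀ a : J, ∀ α₀ : ℝ, 0 < α₀ → α₀ ≤ cL → InAk θ.toStage3Params.L (ι a).k (ι a).η α₀ (ι a).Ω (ι a).U₀ →
      ∃ (g Δ : (Site θ.toStage3Params.D → θ.toStage3Params.𝔸) →ₗ[ℂ] (Site θ.toStage3Params.D → θ.toStage3Params.𝔸)) (q : (Site θ.toStage3Params.D → θ.toStage3Params.𝔸) →ₗ[ℂ] (ℕ → Site θ.toStage3Params.D → θ.toStage3Params.𝔸)) (qs : (ℕ → Site θ.toStage3Params.D → θ.toStage3Params.𝔸) →ₗ[ℂ] (Site θ.toStage3Params.D → θ.toStage3Params.𝔸))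
        (Aw c : (ℕ → Site θ.toStage3Params.D → θ.toStage3Params.𝔸) →ₗ[ℂ] (ℕ → Site θ.toStage3Params.D → θ.toStage3Params.𝔸)) (H' : XSpace θ.toStage3Params.D (ι a).k θ.toStage3Params.𝔸 →ₗ[ℂ] (Site θ.toStage3Params.D → θ.toStage3Params.𝔸)),
        (∀ x : Site θ.toStage3Params.D → θ.toStage3Params.𝔸, (∃ C : ℝ, ∀ y, ‖x y‖ ≤ C) → g (Δ x + qs (Aw (q x))) = x) ∧ (∀ φ, qs (c (q (g (g (qs φ))))) = qs φ) ∧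
        (∀ (f : Site θ.toStage3Params.D → θ.toStage3Params.𝔸), ∀ x ∈ (ι a).Ω 0, Δ f x = covLap (ι a).η (ι a).U₀ (((ι a).Ω 0).indicator f) x) ∧
        (∀ (μ : ℕ → Site θ.toStage3Params.D → θ.toStage3Params.𝔸), ∀ x ∈ (ι a).Ω 0, qs μ x = QT θ.toStage3Params.L (ι a).k (ι a).Λ (ι a).U₀ μ x) ∧
        (∀ (f : Site θ.toStage3Params.D → θ.toStage3Params.𝔸) (n : ℕ), n ≤ (ι a).k → ∀ y ∈ (ι a).Λ n, q f n y = QprimeIter (zdBlocking θ.toStage3Params.D θ.toStage3Params.L) (bgT θ.toStage3Params.L (ι a).U₀) n f y) ∧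
        (∀ (f : Site θ.toStage3Params.D → θ.toStage3Params.𝔸) (n : ℕ) (y : Site θ.toStage3Params.D), ¬ (n ≤ (ι a).k ∧ y ∈ (ι a).Λ n) → q f n y = 0) ∧
        (∀ (X : XSpace θ.toStage3Params.D (ι a).k θ.toStage3Params.𝔸) (x : Site θ.toStage3Params.D), ‖H' X x‖ ≤ B₀'H * ‖X‖) ∧
        (∀ n, n ≤ (ι a).k → ∀ (X : XSpace θ.toStage3Params.D (ι a).k θ.toStage3Params.𝔸), ∀ p ∈ {b : Site θ.toStage3Params.D × Fin θ.toStage3Params.D | SideTouches ((ι a).Ω n) b.1 b.2},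
          wt θ.toStage3Params.L (ι a).η n * ‖covDerivFwd (ι a).η (ι a).U₀ p.2 (H' X) p.1‖ ≤ B₀'H * ‖X‖) ∧
        (∀ X : XSpace θ.toStage3Params.D (ι a).k θ.toStage3Params.𝔸, Bd2 θ.toStage3Params.L (ι a).η (ι a).k (ι a).Ω (covLap (ι a).η (ι a).U₀ (H' X)) (B₂' * ‖X‖)) ∧
        (∀ (Y : XSpace θ.toStage3Params.D (ι a).k θ.toStage3Params.𝔸) (n : ℕ) (hn : n ≤ (ι a).k) (y : Site θ.toStage3Params.D), y ∈ (ι a).Λ n →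
          QprimeIter (zdBlocking θ.toStage3Params.D θ.toStage3Params.L) (bgT θ.toStage3Params.L (ι a).U₀) n (H' Y) y = Y (⟨n, Nat.lt_succ_of_le hn⟩, y)) ∧
        (∀ (f : Site θ.toStage3Params.D → θ.toStage3Params.𝔸) (r : ℝ), 0 ≤ r → Bd2 θ.toStage3Params.L (ι a).η (ι a).k (ι a).Ω f r →
          (∀ x, ‖g f x‖ ≤ BG * r) ∧ ∀ n, n ≤ (ι a).k → ∀ p ∈ {b : Site θ.toStage3Params.D × Fin θ.toStage3Params.D | SideTouches ((ι a).Ω n) b.1 b.2},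
            wt θ.toStage3Params.L (ι a).η n * ‖covDerivFwd (ι a).η (ι a).U₀ p.2 (g f) p.1‖ ≤ BG * r) ∧
        (∀ (f : Site θ.toStage3Params.D → θ.toStage3Params.𝔸) (r : ℝ), 0 ≤ r → Bd2 θ.toStage3Params.L (ι a).η (ι a).k (ι a).Ω f r →
          Bd2 θ.toStage3Params.L (ι a).η (ι a).k (ι a).Ω (f - g (qs (c (q (g f))))) (BR * r)))
    -- PROPOSITION 6 (displayed), PROPOSITION 7 and THEOREM 8 SURVIVING AT THE REPAIRED MEMBERS (hypotheses)
    -- PROPOSITION 6 on the record's cube family at the cut constant `c₁` (DISPLAYED: its cube-socket road `SLetC`∕`SB9C` is certified unsatisfiable, p508450)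
    (c₁ : ℝ) (p6 : B8.Prop6Printed θ.toStage3Params.D (θ.toStage3Params.L : ℝ) lam.B₁ c₁ (fun j : IdxB8SubB θ.toStage3Params => cubB8OfRecord θ.toStage3Params j.1))
    (p7 : B8SectGH.Prop7PrintedR (fun j : IdxB8SubB θ.toStage3Params => famB8OfRecordSubB θ.toStage3Params lam.β lam.len j) (fun j => lam.toAxial j.1))
    -- THEOREM 8's INPUTS AT THE LAW MEMBERS: constants (print p. 101 «only some constants change»), the layer equations, the sourced free-constant
    -- guard of the Proposition-5 providers, and the TWO remaining SOURCED sockets — [Balaban1985BackgroundPropagators] Thm 3.3 WITH SOURCE in Theorem 4's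
    -- frame at the gauge condition (1.146) (`SH59src`, threshold `c59`) and in Proposition 3's frame (`SB9srcH`, threshold `cP3`) — each demanded ONLY at
    -- members `i` with `Ω₀ = ℤᵈ` obeying the four laws; Proposition 5 ∃∕! with source and Proposition 3 with source are SUPPLIED inside from them
    {c59 cP3 γ₈ γ' γ'' γβ B₈ B₈β : ℝ} (hc59 : 0 < c59) (hcP3 : 0 < cP3) (hγ₈ : 1 ≤ γ₈) (hγ' : 0 ≤ γ') (hγ'' : 0 ≤ γ'') (hB₀8 : lam.inp.B₀ ≤ B₈)
    (hγB : 5 * (θ.toStage3Params.D : ℝ) * θ.toStage3Params.L * lam.inp.B₀ + 2 * (γ' * lam.inp.B₀) ≤ 5 * (θ.toStage3Params.D : ℝ) * θ.toStage3Params.L * B₈)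
    (hγB'' : 5 * (θ.toStage3Params.D : ℝ) * θ.toStage3Params.L * lam.inp.B₀ + 2 * (γ'' * lam.inp.B₀) ≤ 5 * (θ.toStage3Params.D : ℝ) * θ.toStage3Params.L * B₈)
    (hB8β : 5 * (θ.toStage3Params.D : ℝ) * θ.toStage3Params.L * lam.B₀β + 2 * lam.B₀β * (γ'' * lam.inp.B₀) + γβ ≤ 5 * (θ.toStage3Params.D : ℝ) * θ.toStage3Params.L * B₈β)
    (hB₁eq : lam.B₁ = 5 * (θ.toStage3Params.D : ℝ) * θ.toStage3Params.L * B₈ * (1 + 11 * (θ.toStage3Params.D : ℝ) ^ 2)) (hB₂eq : lam.B₂ = 5 * (θ.toStage3Params.D : ℝ) * θ.toStage3Params.L * B₈β * (1 + 11 * (θ.toStage3Params.D : ℝ) ^ 2))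
    (hfreeS : 3 * (2 * (θ.toStage3Params.D : ℝ) * (θ.toStage3Params.L : ℝ) ^ 2) * BG * BR * (B₈ + γ₈) ≤ lam.inp.B₀' * B₈)
    (SH59src : ∀ i : ZdIdx θ.toStage3Params.D θ.toStage3Params.L, i.Ω 0 = Set.univ → IdxB8LawsB θ.toStage3Params.L i → ∀ α₀ α₁ : ℝ, 0 < α₀ → 0 < α₁ → α₀ + α₁ ≤ c59 →
      ∀ U₀ U' : Site θ.toStage3Params.D → Fin θ.toStage3Params.D → θ.toStage3Params.𝔸ˣ, (∀ x κ, U₀ x κ ∈ unitaryUnits θ.toStage3Params.𝔸) → (∀ x κ, U' x κ ∈ unitaryUnits θ.toStage3Params.𝔸) →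
      ∀ φ : Site θ.toStage3Params.D → θ.toStage3Params.𝔸, ((InR138 θ.toStage3Params.L i.k i.η (i.Ω 0) (i.Λs i.k) U₀ φ ∧ (∀ x, IsSelfAdjoint (φ x)) ∧ (∀ x, x ∉ i.Ω 0 → φ x = 0) ∧
          Bdd θ.toStage3Params.L i.k i.η (-(2 : ℝ)) (fun j (x : Site θ.toStage3Params.D) => x ∈ i.Ω j) φ) ∧
        msup θ.toStage3Params.L i.k i.η (-(2 : ℝ)) (fun j (x : Site θ.toStage3Params.D) => x ∈ i.Ω j) φ < γ₈ * (α₀ + α₁)) →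
      InAk θ.toStage3Params.L i.k i.η α₀ i.Ω U₀ → InAk θ.toStage3Params.L i.k i.η α₀ i.Ω (mulCfg U' U₀) → (∀ m, m ≤ i.k → InAx θ.toStage3Params.L m (i.Λs m) U₀ (mulCfg U' U₀)) →
      (∀ j, j ≤ i.k → ∀ (z : Site θ.toStage3Params.D) (μ : Fin θ.toStage3Params.D), (∀ x, InBox (loK θ.toStage3Params.L j z) (bondHiK θ.toStage3Params.L j z μ) x → x ∈ i.Ω j) →
        ‖(avgIter θ.toStage3Params.L (mulCfg U' U₀) j z μ : θ.toStage3Params.𝔸) - (avgIter θ.toStage3Params.L U₀ j z μ : θ.toStage3Params.𝔸)‖ ≤ α₁) →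
      (∀ b ∈ {b : Site θ.toStage3Params.D × Fin θ.toStage3Params.D | SideTouches (i.Ω 0) b.1 b.2}, ‖((U' b.1 b.2 : θ.toStage3Params.𝔸ˣ) : θ.toStage3Params.𝔸) - 1‖ ≤ α₁) →
      (∀ m, 1 ≤ m → m ≤ i.k → ∀ (u : Site θ.toStage3Params.D → θ.toStage3Params.𝔸ˣ) (W : Site θ.toStage3Params.D → Fin θ.toStage3Params.D → θ.toStage3Params.𝔸ˣ) (A' : Site θ.toStage3Params.D → Fin θ.toStage3Params.D → θ.toStage3Params.𝔸),
        (∀ x, u x ∈ unitaryUnits θ.toStage3Params.𝔸) → mgauge U₀ u W = U' → Restr129 θ.toStage3Params.L m (i.Λs m) U₀ u → LanF146 θ.toStage3Params.L i.k i.η (i.Ω 0) i.Λs U₀ φ m W →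
        (∀ y τ, IsSelfAdjoint (A' y τ)) →
        (∀ j, j ≤ m → ∀ y τ, SideTouches (i.Ω j) y τ →
        W y τ = cfgExp i.η A' y τ ∧ ‖A' y τ‖ ≤ (2 * (θ.toStage3Params.L * (5 * (θ.toStage3Params.D : ℝ) * θ.toStage3Params.L * B₈ * (α₀ + α₁))) + 8 * (8 * lam.inp.B₀' * (5 * (θ.toStage3Params.D : ℝ) * θ.toStage3Params.L * B₈) * (α₀ + α₁))) * ((θ.toStage3Params.L : ℝ) ^ j * i.η)⁻¹) →
        (∀ y τ, (∀ j, j ≤ m → ¬ SideTouches (i.Ω j) y τ) → A' y τ = 0) →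
        msup θ.toStage3Params.L m i.η (-(1 : ℝ)) (fun j (b : Site θ.toStage3Params.D × Fin θ.toStage3Params.D) => SideTouches (i.Ω j) b.1 b.2) (fun b => A' b.1 b.2)
        ≤ lam.inp.B₀ * (bondNorm θ.toStage3Params.L m i.η (-(3 : ℝ)) i.Ω (fun x μ => Jcur i.η U₀ A' μ x)
        + wsup 1 (fun p : {p : ℕ × (Site θ.toStage3Params.D × Fin θ.toStage3Params.D) // p.1 ≤ m ∧ p.2 ∈ i.Λb m p.1} =>
        linCovIter θ.toStage3Params.L U₀ (iEta i.η A') p.1.1 p.1.2.1 p.1.2.2)) + γ' * lam.inp.B₀ * (α₀ + α₁) ∧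
        msup θ.toStage3Params.L m i.η (-(2 : ℝ)) (fun j (t : Fin θ.toStage3Params.D × Fin θ.toStage3Params.D × Site θ.toStage3Params.D) => SideTouches (i.Ω j) t.2.2 t.2.1)
        (fun t => covDerivFwd i.η U₀ t.1 (fun z => A' z t.2.1) t.2.2)
        ≤ lam.inp.B₀ * (bondNorm θ.toStage3Params.L m i.η (-(3 : ℝ)) i.Ω (fun x μ => Jcur i.η U₀ A' μ x)
        + wsup 1 (fun p : {p : ℕ × (Site θ.toStage3Params.D × Fin θ.toStage3Params.D) // p.1 ≤ m ∧ p.2 ∈ i.Λb m p.1} =>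
        linCovIter θ.toStage3Params.L U₀ (iEta i.η A') p.1.1 p.1.2.1 p.1.2.2)) + γ' * lam.inp.B₀ * (α₀ + α₁)))
    (SB9srcH : ∀ i : ZdIdx θ.toStage3Params.D θ.toStage3Params.L, i.Ω 0 = Set.univ → IdxB8LawsB θ.toStage3Params.L i → ∀ α₀ α₁ α₂ : ℝ, 0 < α₀ → α₀ ≤ cP3 → 0 < α₁ → 0 < α₂ → α₂ ≤ cP3 →
      ∀ (U₀ W : Site θ.toStage3Params.D → Fin θ.toStage3Params.D → θ.toStage3Params.𝔸ˣ), (∀ x κ, U₀ x κ ∈ unitaryUnits θ.toStage3Params.𝔸) → (∀ x κ, W x κ ∈ unitaryUnits θ.toStage3Params.𝔸) →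
      ∀ f : Site θ.toStage3Params.D → θ.toStage3Params.𝔸, InR138 θ.toStage3Params.L i.k i.η (i.Ω 0) (i.Λs i.k) U₀ f →
      (∀ x, IsSelfAdjoint (f x)) → (∀ x, x ∉ i.Ω 0 → f x = 0) →
      Bdd θ.toStage3Params.L i.k i.η (-(2 : ℝ)) (fun j (x : Site θ.toStage3Params.D) => x ∈ i.Ω j) f →
      msup θ.toStage3Params.L i.k i.η (-(2 : ℝ)) (fun j (x : Site θ.toStage3Params.D) => x ∈ i.Ω j) f < γ₈ * (α₀ + α₁) →
      msup θ.toStage3Params.L i.k i.η (-(3 : ℝ)) (fun j (p : Fin θ.toStage3Params.D × Site θ.toStage3Params.D) => p.2 ∈ i.Ω j) (fun p => covDerivFwd i.η U₀ p.1 f p.2) < γ₈ * (α₀ + α₁) →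
      InAk θ.toStage3Params.L i.k i.η α₀ i.Ω U₀ → InAk θ.toStage3Params.L i.k i.η α₀ i.Ω (mulCfg W U₀) → IsLandau146W θ.toStage3Params.L i.k i.η (i.Ω 0) (i.Λs i.k) U₀ f W →
      ∀ A' : Site θ.toStage3Params.D → Fin θ.toStage3Params.D → θ.toStage3Params.𝔸, (∀ y τ, IsSelfAdjoint (A' y τ)) →
      (∀ j, j ≤ i.k → ∀ (y : Site θ.toStage3Params.D) (τ : Fin θ.toStage3Params.D), SideTouches (i.Ω j) y τ →
        W y τ = cfgExp i.η A' y τ ∧ ‖A' y τ‖ ≤ α₂ * ((θ.toStage3Params.L : ℝ) ^ j * i.η)⁻¹) →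
      (∀ (y : Site θ.toStage3Params.D) (τ : Fin θ.toStage3Params.D), (∀ j, j ≤ i.k → ¬ SideTouches (i.Ω j) y τ) → A' y τ = 0) →
      msup θ.toStage3Params.L i.k i.η (-(1 : ℝ)) (fun j (b : Site θ.toStage3Params.D × Fin θ.toStage3Params.D) => SideTouches (i.Ω j) b.1 b.2) (fun b => A' b.1 b.2)
          ≤ lam.inp.B₀ * (bondNorm θ.toStage3Params.L i.k i.η (-(3 : ℝ)) i.Ω (fun x μ => Jcur i.η U₀ A' μ x)
            + wsup 1 (fun p : {p : ℕ × (Site θ.toStage3Params.D × Fin θ.toStage3Params.D) // p.1 ≤ i.k ∧ p.2 ∈ i.Λb i.k p.1} =>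
                linCovIter θ.toStage3Params.L U₀ (iEta i.η A') p.1.1 p.1.2.1 p.1.2.2)) + γ'' * lam.inp.B₀ * (α₀ + α₁) ∧
        msup θ.toStage3Params.L i.k i.η (-(2 : ℝ)) (fun j (t : Fin θ.toStage3Params.D × Fin θ.toStage3Params.D × Site θ.toStage3Params.D) => SideTouches (i.Ω j) t.2.2 t.2.1)
            (fun t => covDerivFwd i.η U₀ t.1 (fun z => A' z t.2.1) t.2.2)
          ≤ lam.inp.B₀ * (bondNorm θ.toStage3Params.L i.k i.η (-(3 : ℝ)) i.Ω (fun x μ => Jcur i.η U₀ A' μ x)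
            + wsup 1 (fun p : {p : ℕ × (Site θ.toStage3Params.D × Fin θ.toStage3Params.D) // p.1 ≤ i.k ∧ p.2 ∈ i.Λb i.k p.1} =>
                linCovIter θ.toStage3Params.L U₀ (iEta i.η A') p.1.1 p.1.2.1 p.1.2.2)) + γ'' * lam.inp.B₀ * (α₀ + α₁) ∧
        bondNorm θ.toStage3Params.L i.k i.η (-(3 : ℝ)) i.Ω (fun x μ => pdiv i.η U₀ (plaqCovDeriv i.η U₀ A') μ x)
          ≤ lam.inp.B₀ * (bondNorm θ.toStage3Params.L i.k i.η (-(3 : ℝ)) i.Ω (fun x μ => Jcur i.η U₀ A' μ x)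
            + wsup 1 (fun p : {p : ℕ × (Site θ.toStage3Params.D × Fin θ.toStage3Params.D) // p.1 ≤ i.k ∧ p.2 ∈ i.Λb i.k p.1} =>
                linCovIter θ.toStage3Params.L U₀ (iEta i.η A') p.1.1 p.1.2.1 p.1.2.2)) + γ'' * lam.inp.B₀ * (α₀ + α₁) ∧
        bondNorm θ.toStage3Params.L i.k i.η (-(3 : ℝ)) i.Ω (fun x μ => covLap i.η U₀ (fun z => A' z μ) x)
          ≤ lam.inp.B₀ * (bondNorm θ.toStage3Params.L i.k i.η (-(3 : ℝ)) i.Ω (fun x μ => Jcur i.η U₀ A' μ x)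
            + wsup 1 (fun p : {p : ℕ × (Site θ.toStage3Params.D × Fin θ.toStage3Params.D) // p.1 ≤ i.k ∧ p.2 ∈ i.Λb i.k p.1} =>
                linCovIter θ.toStage3Params.L U₀ (iEta i.η A') p.1.1 p.1.2.1 p.1.2.2)) + γ'' * lam.inp.B₀ * (α₀ + α₁) ∧
        msup θ.toStage3Params.L i.k i.η (-(2 + lam.β)) (fun j (q : Fin θ.toStage3Params.D × Fin θ.toStage3Params.D × (Site θ.toStage3Params.D × Site θ.toStage3Params.D)) => q.2.2 ∈ AdmPair i.η lam.len ∧ q.2.2.1 ∈ i.Ω j)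
            (fun q => hquot i.η lam.β lam.len U₀ (covDerivFwd i.η U₀ q.1 (fun z => A' z q.2.1)) q.2.2)
          ≤ lam.B₀β * (bondNorm θ.toStage3Params.L i.k i.η (-(3 : ℝ)) i.Ω (fun x μ => Jcur i.η U₀ A' μ x)
            + wsup 1 (fun p : {p : ℕ × (Site θ.toStage3Params.D × Fin θ.toStage3Params.D) // p.1 ≤ i.k ∧ p.2 ∈ i.Λb i.k p.1} =>
                linCovIter θ.toStage3Params.L U₀ (iEta i.η A') p.1.1 p.1.2.1 p.1.2.2)) + γβ * (α₀ + α₁))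
    {γw : ℝ} (hγ0 : 0 < γw) (hγ1 : γw ≤ θ.γ) :
    ∃ w w' : WorldP, IsRecordOfRecord₁₃CSepCoPHSX3H F N (datumOfRecord₁₃SepCoPH F N θ h) w ∧
      w.C = (datumOfRecord₁₃SepCoPH F N θ h).C ∧ w.γ = γw ∧ w.L = (θ.L : ℝ) ∧
      (∀ P : B12.RunParams, w.up P =
        upOfRecord₅CS F N ((θ.pinX3H F N (lam.cutSubB J (fun a : J => zdLan θ.toStage3Params.L lam.B₁ (ι a)) c₁) lam12 lam13).toStage5₁₃CoPH F N) P) ∧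
      (∀ P : B12.RunParams, (leavesP w P).b8 ∧ Dag.B8_main (leavesP w P)) ∧
      IsRecordOfRecord₁₃CSepCoPH F N (datumOfRecord₁₃SepCoPH F N θ h) w' ∧ w'.C = w.C ∧ w'.γ = w.γ ∧ w'.L = w.L ∧
      ∀ P : B12.RunParams, leavesP w P = { leavesP w' P with b8 := (leavesP w P).b8 } := by
  have hleaf := b8LeafOfRecordSubBH_cutSubB_zdLan_of_knit_lettersRDUB_univ_t8srv lam hD hB₁' hB hB₀β hC₂ hcB9 hB₀'H hB₂' hBG hBR hcL hfree hfree2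
    SLet SLetUB SB9all ι hΩ0L hΩL htowerL SLetL SLetLU c₁ p6 p7 hc59 hcP3 hγ₈ hγ' hγ'' hB₀8 hγB hγB'' hB8β hB₁eq hB₂eq hfreeS SH59src SB9srcH
  obtain ⟨w₀, -, -⟩ := exists_world_isRecordOfRecord₁₃CSepCoPH F N θ h hθ ⟨hγ0, hγ1⟩
  have hrec : IsRecordOfRecord₁₃CSepCoPHSX3H F N (datumOfRecord₁₃SepCoPH F N θ h)
      { w₀ with
        C := (datumOfRecord₁₃SepCoPH F N θ h).C, γ := γw, L := (θ.L : ℝ), one_lt_L := by exact_mod_cast θ.hL.2,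
        up := fun P => upOfRecord₅CS F N
          ((θ.pinX3H F N (lam.cutSubB J (fun a : J => zdLan θ.toStage3Params.L lam.B₁ (ι a)) c₁) lam12 lam13).toStage5₁₃CoPH F N) P } :=
    ⟨θ, h, _, lam12, lam13, hθ, rfl, rfl, ⟨hγ0, hγ1⟩, rfl, fun _ => rfl⟩
  obtain ⟨w', hw', hC', hγ', hL', hleaves, -⟩ := companion_of_isRecordOfRecord₁₃CSepCoPHSX3H hrec
  refine ⟨_, w', hrec, rfl, rfl, rfl, fun _ => rfl, fun P => ?_, hw', hC', hγ', hL', hleaves⟩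
  have hb8 : (upOfRecord₅CS F N
      ((θ.pinX3H F N (lam.cutSubB J (fun a : J => zdLan θ.toStage3Params.L lam.B₁ (ι a)) c₁) lam12 lam13).toStage5₁₃CoPH F N) P).b8 :=
    (socket05S_toStage5₁₃CoPH_pinX3H_iff F N θ _ lam12 lam13 P).2 hleaf
  obtain ⟨h8iff, -, -⟩ := b8_b11_b10_main_iff_of_isRecordOfRecord₁₃CSepCoPHSX3H hrec P
  exact ⟨hb8, h8iff.2 fun _ => hb8⟩

end Record

#print axioms exists_isRecordOfRecord₁₃CSepCoPHSX3H_b8_of_knit_lettersRDUB_univ_t8srv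

end Summit.QuantumFields.YangMills.BalabanUVNodes.N05AtXPinnedHSSepCoPHT8Srv

end
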